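import Mathlib
import HarnessLib
import Summits.CriticalPhenomena.SAWScalingLimit.Theorems.SAWSpinMonotoneQCIdentificationDefs
import Literature.Probability.RandomPlanarGeometry.HexSAWPathRigidity
import Literature.Probability.RandomPlanarGeometry.HexParafermionSpinShift

/-!
# Stub `stub_boundaryPhaseLaw` of line `eight_fifths_primitive` (crux `QCIdentification`)

Item stmt-CriticalPhenomena-16772, namespace of the checked skeleton
`Cruxes/QCIdentification/Lines/eight_fifths_primitive.lean`; vocabulary from the landed module
`Theorems/SAWSpinMonotoneQCIdentificationDefs.lean` (`Fobs`, `BoundaryPhaseLaw`).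

The **exact boundary phase law** of the Duminil-Copin–Smirnov parafermionic observable
`F(z) = Σ_{γ ⊂ Ω : a → z} e^{-i(5/8)W_γ} x_c^{ℓ(γ)}` (`hexParafermionicObservable`, abbreviated
`Fobs`): for a simply connected `Λ`, a boundary source `a = {u_a, v_a}` (`v_a ∈ Λ`, `u_a ∉ Λ`)
and another boundary mid-edge `p = {u, v}` (`v ∈ Λ`, `u ∉ Λ`),
`F(p)^8 · (c u - c v)^5 = -‖F(p)‖^8 · (c u_a - c v_a)^5` (`BoundaryPhaseLaw`).

Proof. Every walk `γ : a → p` has the same winding `W` (rigidity between boundary mid-edges,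
`HexMidEdgeSAW.winding_eq_of_mem_boundary`), so `F(p) = e^{-i(5/8)W} Z` with
`Z = Σ_γ x_c^{ℓ(γ)} ≥ 0`, `‖F(p)‖ = Z` and `F(p)^8 = e^{-5iW} Z^8`. The winding rotates the
initial unit direction `u_a → v_a` onto the final one `v → u` (the last visited vertex is `v`,
since `u ∉ Λ`), both edges having length `1/√3`: `e^{iW} = (c u - c v)/(c v_a - c u_a)`
(telescoping, `exp_winding_mul_I`). Hence
`e^{-5iW}(c u - c v)^5 = (c v_a - c u_a)^5 = -(c u_a - c v_a)^5`; without walks both sides vanish.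

Source: H. Duminil-Copin, S. Smirnov, Ann. of Math. 175 (2012) 1653–1665 (arXiv:1007.0575),
§2–§3 (Definition 1; proof of Lemma 2, where boundary windings are evaluated by their common
value).
-/

noncomputable section

open scoped BigOperators
open Literature.Probability.LatticeModels Literature.Probability.RandomPlanarGeometry
open Literature.Probability.RandomPlanarGeometry.SAW
open Literature.Barriers.CriticalPhenomena
open Summit.CriticalPhenomena.SAWScalingLimit.Theses.SAWDevelopingMap

namespace Summit.CriticalPhenomena.SAWScalingLimit.Cruxes.QCIdentification.EightFifthsPrimitive

/-- **Direction identity of a walk between boundary mid-edges.** For a walk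
`γ : {u_a, v_a} → {u, v}` of a domain `Λ` with `u_a, u ∉ Λ`, `v ∼ u`, visiting at least one
vertex, `e^{iW_γ} = (c u - c v)/(c v_a - c u_a)`: the walk starts at `v_a` heading away from `u_a`
and ends at `v` heading towards `u`. (Adapted from `HexMidEdgeSAW.exp_two_mul_winding_mul_I`,
where the side from which the target is reached is unknown and only the square is determined.)
[folklore] -/
theorem exp_winding_mul_I_eq_div_of_boundary {Λ : Finset HexVertex} {ua va u v : HexVertex}
    (hua : ua ∉ Λ) (hu : u ∉ Λ) (hvu : hexGraph.Adj v u) (hva : hexGraph.Adj va ua)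
    (γ : HexMidEdgeSAW Λ s(ua, va) s(u, v)) (hne : γ.verts ≠ []) :
    Complex.exp ((γ.winding : ℂ) * Complex.I) =
      (hexCenter u - hexCenter v) / (hexCenter va - hexCenter ua) := by
  have huw : hexGraph.Adj ua va := hva.symm
  -- the first vertex is `va`
  have hhead := γ.head_eq rfl hua hne
  obtain ⟨x₀, rest, hx₀⟩ := List.exists_cons_of_ne_nil hne
  have hx₁ : x₀ = va := by rw [← hhead]; simp [hx₀]
  have hx : γ.verts = va :: rest := by rw [hx₀, hx₁]
  clear hx₀ hx₁
  -- the chain of distinct consecutive points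
  have hchain : List.IsChain (· ≠ ·)
      (hexMidpoint s(ua, va) :: (γ.verts.map hexCenter ++ [hexMidpoint s(u, v)])) := by
    refine γ.map_chain_ne hvu.symm hne (hexMidpoint s(ua, va)) (fun y hy => ?_)
    rw [hx] at hy
    simp only [List.head?_cons, Option.some.injEq] at hy
    rw [← hy, hexMidpoint_mk]
    intro he
    apply hexCenter_ne_of_adj huw
    linear_combination (2 : ℂ) * he
  have hpts : γ.points =
      hexMidpoint s(ua, va) :: (γ.verts.map hexCenter ++ [hexMidpoint s(u, v)]) := rfl
  -- first increment
  have hfirst : hexCenter va - hexMidpoint s(ua, va) =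
      (1 / 2 : ℂ) * (hexCenter va - hexCenter ua) := by
    rw [hexMidpoint_mk]; ring
  -- the last vertex is `v` (`u ∉ Λ`)
  have hlastv : γ.verts.getLast hne = v := by
    rcases γ.getLast_eq_or hne with h | h
    · exact absurd (h ▸ γ.subset _ (List.getLast_mem hne)) hu
    · exact h
  have hLg : γ.verts = γ.verts.dropLast ++ [v] := by
    conv_lhs => rw [← List.dropLast_append_getLast hne, hlastv]
  have hlast : lastStep (hexMidpoint s(ua, va)) (hexCenter va)
      ((rest.map hexCenter) ++ [hexMidpoint s(u, v)]) = hexMidpoint s(u, v) - hexCenter v := by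
    have hwr : va :: rest = γ.verts.dropLast ++ [v] := by rw [← hx]; exact hLg
    rcases hL : γ.verts.dropLast with _ | ⟨y, L₁⟩
    · rw [hL] at hwr
      simp only [List.nil_append, List.cons.injEq] at hwr
      obtain ⟨h1, h2⟩ := hwr
      rw [h2, h1]
      simp [lastStep]
    · rw [hL] at hwr
      simp only [List.cons_append, List.cons.injEq] at hwr
      obtain ⟨-, h2⟩ := hwr
      rw [h2, List.map_append, List.map_cons, List.map_nil, List.append_assoc,
        List.singleton_append]
      exact lastStep_eq _ _ _ _ _
  have hexpW := exp_winding_mul_I ((rest.map hexCenter) ++ [hexMidpoint s(u, v)])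
    (hexMidpoint s(ua, va)) (hexCenter va) (by simpa [hx] using hchain)
  have hW : γ.winding = Literature.Probability.LatticeModels.winding
      (hexMidpoint s(ua, va) :: hexCenter va ::
        ((rest.map hexCenter) ++ [hexMidpoint s(u, v)])) := by
    rw [HexMidEdgeSAW.winding, hpts, hx]; rfl
  rw [hlast, hfirst] at hexpW
  have hle : hexMidpoint s(u, v) - hexCenter v = (1 / 2 : ℂ) * (hexCenter u - hexCenter v) := by
    rw [hexMidpoint_mk]; ring
  rw [hW, hexpW, hle]
  have hn1 : ‖(1 / 2 : ℂ) * (hexCenter u - hexCenter v)‖ =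
      (1 / 2 : ℝ) * ‖hexCenter u - hexCenter v‖ := by
    rw [norm_mul]; norm_num
  have hn2 : ‖(1 / 2 : ℂ) * (hexCenter va - hexCenter ua)‖ =
      (1 / 2 : ℝ) * ‖hexCenter va - hexCenter ua‖ := by
    rw [norm_mul]; norm_num
  rw [hn1, hn2, norm_hexCenter_sub_of_adj hvu, norm_hexCenter_sub_of_adj huw]
  have h3 : (((1 / 2 : ℝ) * (Real.sqrt 3)⁻¹ : ℝ) : ℂ) ≠ 0 := by
    exact_mod_cast mul_ne_zero (by norm_num) (inv_ne_zero (Real.sqrt_ne_zero'.2 (by norm_num)))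
  rw [div_div_div_cancel_right₀ h3, mul_div_mul_left _ _ (by norm_num : (1 / 2 : ℂ) ≠ 0)]

/-- **Exact boundary phase law** `F(p)^8 · (c u - c v)^5 = -‖F(p)‖^8 · (c u_a - c v_a)^5` for the
critical spin-`5/8` observable between boundary mid-edges of a simply connected domain
(registered stub `stub_boundaryPhaseLaw` of the line `eight_fifths_primitive`).
[cite: DuminilCopinSmirnov2012, §3 proof of Lemma 2] -/
theorem stub_boundaryPhaseLaw : BoundaryPhaseLaw := by
  intro Λ hΛ ua va hva hua hadj u v hv hu hvu hne
  -- both mid-edges are boundary mid-edges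
  have ha : s(ua, va) ∈ hexDomainBoundary Λ :=
    ⟨(SimpleGraph.mem_edgeSet hexGraph).2 hadj.symm, ua, va, rfl, hva, hua⟩
  have hb : s(u, v) ∈ hexDomainBoundary Λ :=
    ⟨(SimpleGraph.mem_edgeSet hexGraph).2 hvu.symm, u, v, rfl, hv, hu⟩
  rcases isEmpty_or_nonempty (HexMidEdgeSAW Λ s(ua, va) s(u, v)) with hE | hN
  · -- no walk: `F = 0`
    have h0 : Fobs Λ s(ua, va) s(u, v) = 0 := by
      simp [Fobs, hexParafermionicObservable]
    rw [h0]
    simp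
  · -- all walks have the winding `W` of some walk `γ₀`
    obtain ⟨γ₀⟩ := hN
    set W : ℝ := γ₀.winding with hWdef
    have hWγ : ∀ γ : HexMidEdgeSAW Λ s(ua, va) s(u, v), γ.winding = W := fun γ =>
      HexMidEdgeSAW.winding_eq_of_mem_boundary hΛ ha hb γ γ₀
    -- the non-negative amplitude `Z = Σ_γ x_c^{ℓ(γ)}`
    set Z : ℝ := ∑ γ : HexMidEdgeSAW Λ s(ua, va) s(u, v), hexCriticalFugacity ^ γ.length with hZ
    have hZ0 : 0 ≤ Z :=
      Finset.sum_nonneg fun γ _ => pow_nonneg hexCriticalFugacity_pos_lt_one.1.le _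
    have hF : Fobs Λ s(ua, va) s(u, v) =
        Complex.exp (-Complex.I * ((5 / 8 : ℝ) : ℂ) * (W : ℂ)) * (Z : ℂ) := by
      simp only [Fobs, hexParafermionicObservable, HexMidEdgeSAW.weight]
      rw [hZ, Complex.ofReal_sum, Finset.mul_sum]
      refine Finset.sum_congr rfl fun γ _ => ?_
      rw [hWγ γ, Complex.ofReal_pow]
    have hnorm : ‖Fobs Λ s(ua, va) s(u, v)‖ = Z := by
      rw [hF, norm_mul, Complex.norm_exp, Complex.norm_real, Real.norm_of_nonneg hZ0]
      simp
    -- the direction identity for `γ₀`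
    have hne0 : γ₀.verts ≠ [] := fun h => hne (γ₀.eq_of_nil h).symm
    have hexp := exp_winding_mul_I_eq_div_of_boundary hua hu hvu hadj γ₀ hne0
    have hcu : hexCenter va - hexCenter ua ≠ 0 := sub_ne_zero.2 (hexCenter_ne_of_adj hadj)
    have hcv : hexCenter u - hexCenter v ≠ 0 := sub_ne_zero.2 (hexCenter_ne_of_adj hvu.symm)
    set r : ℂ := (hexCenter u - hexCenter v) / (hexCenter va - hexCenter ua) with hr
    have hr0 : r ≠ 0 := div_ne_zero hcv hcu
    have h8 : Complex.exp (-Complex.I * ((5 / 8 : ℝ) : ℂ) * (W : ℂ)) ^ 8 = (r ^ 5)⁻¹ := by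
      rw [← hexp, ← Complex.exp_nat_mul, ← Complex.exp_nat_mul, ← Complex.exp_neg]
      congr 1
      push_cast
      ring
    have hcuv : hexCenter u - hexCenter v = r * (hexCenter va - hexCenter ua) := by
      rw [hr, div_mul_cancel₀ _ hcu]
    rw [hnorm, hF, mul_pow, h8, hcuv]
    field_simp
    ring

end Summit.CriticalPhenomena.SAWScalingLimit.Cruxes.QCIdentification.EightFifthsPrimitive

end
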